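import Summits.HodgeConjecture.HodgeConjecture.Theorems.Ring2WeilCoverageCMUnitSignature
import Mathlib.RingTheory.Norm.Transitivity
import Mathlib.FieldTheory.IntermediateField.Adjoin.Basic
import HarnessLib

/-!
# Weil-type family coverage — the TWISTED unit-signature obstruction: positivity of the real units' RELATIVE
# norms to a subfield `ℚ(s) ⊂ K⁺` at every real place of `ℚ(s)`, and an odd sign count on the embeddings ABOVE
# one place, forbid `Φ`-positive divisors of type `𝔣₀` (the census's second `𝔽₂`-condition `λ` at `M = 39, 56`)

research route conditional on HC_CM; not a corollary; Q11.4-sentence-2 already refuted in dim ≥ 3.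

Ring 2, WEIL-TYPE FAMILY-COVERAGE CENSUS (`HOME/WEIL-FAMILY-COVERAGE.md` `## b01`, block b01.25 (A): «at `M = 39`
and `M = 56` the annihilator of the unit sign matrix is `{0, parity, λ, λ + parity}` with `λ = Σ` over the places
`{t : χ′(t) = +1}`, `χ′ = χ₁₃ / χ₈` — every unit of `ℚ(ζ₃₉)⁺ / ℚ(ζ₅₆)⁺` has totally positive relative norm to
`ℚ(√13) / ℚ(√2)`»; owner ring2-b01), part 33 of the `Ring2WeilCoverage*` series — the TWISTED form of part 2
(`…CMUnitSignature`).  Part 2 proved: if every real unit `u` has `∏_{φ∈Φ} Re u^φ > 0` (its norm to `ℚ`) and the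
skew `ζ₀` of type `𝔣₀` is negative at an ODD number of `φ ∈ Φ`, then `ℂ^Φ/D(𝔪)` carries no `Φ`-positive divisor
of type `𝔣₀`.  Here the product and the count are restricted to a SUB-COLLECTION `T` of embeddings — in the
application, the embeddings lying over ONE real place of a subfield `ℚ(s) ⊂ K⁺`:

* §1 `not_exists_pos_isOfType_of_prod_neg_on` / `…_of_odd_on`: for ANY set `T` of embeddings, if every unit `u` of
  `𝔬` fixed by `ρ` has `∏_{φ ∈ Φ ∩ T} Re u^φ > 0` and `#{φ ∈ Φ ∩ T : Im ζ₀^φ < 0}` is ODD, then NO `Φ`-positive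
  divisor of type `𝔣₀` exists on `ℂ^Φ/D(𝔪)` (same two-line argument as part 2, on `Φ ∩ T`).
* §2 (any number field `L`, intermediate field `F`, embedding `σ`) **`prod_filter_eq_norm`:
  `∏_{ψ : L → ℂ, ψ|_F = σ|_F} ψ(x) = σ(N_{L/F}(x))`** (Mathlib `Algebra.norm_eq_prod_embeddings` for the
  `F`-algebra `ℂ` structured by `σ|_F`), and `comp_algebraMap_adjoin_eq_iff`: for `F = ℚ(s)`, `ψ|_F = σ|_F ↔
  ψ(s) = σ(s)` (`RingHom.eqLocusField`).
* §3 for a CM field `K` with `K⁺ = maximalRealSubfield K`, `s ∈ K⁺`: `prod_filter_re_eq_re_norm` — for `x ∈ K⁺` and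
  `φ₀ : K → ℂ`, `∏_{φ ∈ Φ, φ(s) = φ₀(s)} Re (x)^φ = Re φ₀|_{K⁺}(N_{K⁺/ℚ(s)}(x))` (the places of `K⁺` ↔ the elements
  of `Φ`, part 2's `comp_algebraMap_bijective`); and the ENGINE **`not_exists_pos_isOfType_of_relNorm_pos_of_odd`**:
  if every unit `v` of `𝓞 K⁺` has `Re σ(N_{K⁺/ℚ(s)}(v)) > 0` for EVERY embedding `σ` of `K⁺` («the relative norm
  of every unit to `ℚ(s)` is totally positive» — at `ℚ(ζ₃₉)⁺ ⊃ ℚ(√13)` and `ℚ(ζ₅₆)⁺ ⊃ ℚ(√2)` this is parts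
  32/34) and for some `φ₀` the skew `ζ₀` of type `𝔣₀` is negative at an ODD number of the `φ ∈ Φ` with
  `φ(s) = φ₀(s)`, then `ℂ^Φ/D(𝔪)` carries NO `Φ`-positive divisor of type `𝔣₀` (for `𝔣₀ = 𝔬₀`: no `ι`-compatible
  principal polarisation).

HONEST FRAMING: torus-level statements about Shimura's divisors `X_ζ` (as part 2); the arithmetic input (total
positivity of relative norms of units) is a HYPOTHESIS here, discharged at the two census levels in part 34;
nothing here is a statement about Hodge classes, `W_K` or HC; `HC_CM` is used nowhere.  No `def`, no named fact,
no `sorry`.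

References: [cite: Shimura1998, §14.3 Prop. 5, p. 104] (divisors of type `𝔣₀` are the `X_{uζ₀}`); the rest is
[folklore] (norms as products over embeddings).
-/

noncomputable section

open scoped Classical nonZeroDivisors NumberField ComplexConjugate
open NumberField NumberField.ComplexEmbedding Module FractionalIdeal Complex Finset IntermediateField

namespace Summit.HodgeConjecture.Ring2WeilCoverage.TwistedUnitSignature

open Literature.AlgebraicGeometry.Motives (CMType)
open Literature.NumberTheory.ComplexMultiplication
open Literature.NumberTheory.ComplexMultiplication.CMTypeLattice
open Summit.HodgeConjecture.Ring2WeilCoverage.CMTypeSignParity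
open Summit.HodgeConjecture.Ring2WeilCoverage.CMUnitSignature

/-! ### §1 The obstruction on a sub-collection `T` of embeddings -/

section CM

variable {K : Type} [Field K] [NumberField K] [IsCMField K] (Φ : CMType K)
  (𝔪 : (FractionalIdeal (𝓞 K)⁰ K)ˣ) {ζ₀ : K} {𝔣₀ : Ideal (𝓞 (maximalRealSubfield K))}

/-- **Twisted product obstruction.**  For any set `T` of complex embeddings of `K`: if every unit `u` of `𝔬` fixed
by `ρ` has `∏_{φ ∈ Φ ∩ T} Re u^φ > 0` and the skew `ζ₀` of type `𝔣₀` has `∏_{φ ∈ Φ ∩ T} Im ζ₀^φ < 0`, then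
`ℂ^Φ/D(𝔪)` carries NO `Φ`-positive divisor of type `𝔣₀` (a divisor `X_{uζ₀}` positive on `Φ` is positive on
`Φ ∩ T`, where `Re u^φ · Im ζ₀^φ > 0` termwise).
research route conditional on HC_CM; not a corollary; Q11.4-sentence-2 already refuted in dim ≥ 3. [cite: Shimura1998, §14.3 Prop. 5, p. 104] -/
theorem not_exists_pos_isOfType_of_prod_neg_on (T : Set (K →+* ℂ))
    (hζ₀ : IsCMField.complexConj K ζ₀ = -ζ₀) (h0 : ζ₀ ≠ 0) (hT : IsOfType 𝔪 ζ₀ 𝔣₀)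
    (hU : ∀ u : (𝓞 K)ˣ, IsCMField.complexConj K ((u : 𝓞 K) : K) = ((u : 𝓞 K) : K) →
      0 < ∏ φ ∈ univ.filter (fun φ : Φ.1 => φ.1 ∈ T), (φ.1 ((u : 𝓞 K) : K)).re)
    (hneg : ∏ φ ∈ univ.filter (fun φ : Φ.1 => φ.1 ∈ T), (φ.1 ζ₀).im < 0) :
    ¬ ∃ ζ : K, IsCMField.complexConj K ζ = -ζ ∧ (∀ φ : Φ.1, 0 < (φ.1 ζ).im) ∧ IsOfType 𝔪 ζ 𝔣₀ := by
  intro hex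
  obtain ⟨u, hu, hpos⟩ := (exists_pos_isOfType_iff_exists_units Φ 𝔪 hζ₀ h0 hT).mp hex
  have h1 : 0 < ∏ φ ∈ univ.filter (fun φ : Φ.1 => φ.1 ∈ T), ((φ.1 ((u : 𝓞 K) : K)).re * (φ.1 ζ₀).im) :=
    Finset.prod_pos fun φ _ => hpos φ
  rw [Finset.prod_mul_distrib] at h1
  have h2 := mul_neg_of_pos_of_neg (hU u hu) hneg
  linarith

/-- **Twisted parity obstruction**: for any set `T` of embeddings, if every unit of `𝔬` fixed by `ρ` has positive
`(Φ ∩ T)`-product and `#{φ ∈ Φ ∩ T : Im ζ₀^φ < 0}` is ODD, then `ℂ^Φ/D(𝔪)` carries no `Φ`-positive divisor of type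
`𝔣₀` (for `𝔣₀ = 𝔬₀`: no `ι`-compatible principal polarisation).
research route conditional on HC_CM; not a corollary; Q11.4-sentence-2 already refuted in dim ≥ 3. [cite: Shimura1998, §14.3 Prop. 5, p. 104] -/
theorem not_exists_pos_isOfType_of_odd_on (T : Set (K →+* ℂ))
    (hζ₀ : IsCMField.complexConj K ζ₀ = -ζ₀) (h0 : ζ₀ ≠ 0) (hT : IsOfType 𝔪 ζ₀ 𝔣₀)
    (hU : ∀ u : (𝓞 K)ˣ, IsCMField.complexConj K ((u : 𝓞 K) : K) = ((u : 𝓞 K) : K) →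
      0 < ∏ φ ∈ univ.filter (fun φ : Φ.1 => φ.1 ∈ T), (φ.1 ((u : 𝓞 K) : K)).re)
    (hodd : Odd ((Φ.1 ∩ {ψ | ψ ∈ T ∧ (ψ ζ₀).im < 0}).ncard)) :
    ¬ ∃ ζ : K, IsCMField.complexConj K ζ = -ζ ∧ (∀ φ : Φ.1, 0 < (φ.1 ζ).im) ∧ IsOfType 𝔪 ζ 𝔣₀ := by
  refine not_exists_pos_isOfType_of_prod_neg_on Φ 𝔪 T hζ₀ h0 hT hU ?_
  have hne : ∏ φ ∈ univ.filter (fun φ : Φ.1 => φ.1 ∈ T), (φ.1 ζ₀).im ≠ 0 :=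
    Finset.prod_ne_zero_iff.mpr fun φ _ => im_embedding_ne_zero_of_skew hζ₀ h0 φ.1
  have hcard : ((univ.filter (fun φ : Φ.1 => φ.1 ∈ T)).filter fun φ : Φ.1 => (φ.1 ζ₀).im < 0).card =
      (Φ.1 ∩ {ψ | ψ ∈ T ∧ (ψ ζ₀).im < 0}).ncard := by
    rw [Finset.filter_filter]
    convert card_filter_subtype_eq_ncard Φ (fun ψ => ψ ∈ T ∧ (ψ ζ₀).im < 0) using 2
    ext φ
    simp only [Finset.mem_filter]
  have hnot : ¬ (0 < ∏ φ ∈ univ.filter (fun φ : Φ.1 => φ.1 ∈ T), (φ.1 ζ₀).im) := fun h => by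
    have hev := (prod_pos_iff_even_card_filter_neg _ (fun φ : Φ.1 => (φ.1 ζ₀).im)
      (fun φ _ => im_embedding_ne_zero_of_skew hζ₀ h0 φ.1)).mp h
    rw [hcard] at hev
    exact (Nat.not_even_iff_odd.mpr hodd) hev
  exact lt_of_le_of_ne (not_lt.mp hnot) hne

end CM

/-! ### §2 Relative norms as products over the embeddings above one embedding -/

section Norm

variable {L : Type*} [Field L] [NumberField L]

/-- **`∏_{ψ|_F = σ|_F} ψ(x) = σ(N_{L/F}(x))`**: for an intermediate field `F` of the number field `L`, an element
`x ∈ L` and an embedding `σ : L → ℂ`, the product of `ψ(x)` over the embeddings `ψ` of `L` agreeing with `σ` on `F`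
is `σ` of the relative norm `N_{L/F}(x)` (Mathlib `Algebra.norm_eq_prod_embeddings`, with `ℂ` an `F`-algebra
through `σ|_F`; the `F`-algebra maps `L → ℂ` are exactly these `ψ`).
research route conditional on HC_CM; not a corollary; Q11.4-sentence-2 already refuted in dim ≥ 3. [folklore] -/
theorem prod_filter_eq_norm (F : IntermediateField ℚ L) (x : L) (σ : L →+* ℂ) :
    ∏ ψ ∈ univ.filter (fun ψ : L →+* ℂ => ψ.comp (algebraMap F L) = σ.comp (algebraMap F L)), ψ x =
      σ (algebraMap F L (Algebra.norm F x)) := by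
  letI : Algebra F ℂ := (σ.comp (algebraMap F L)).toAlgebra
  have hN := Algebra.norm_eq_prod_embeddings (K := F) (L := L) (E := ℂ) x
  have h1 : σ (algebraMap F L (Algebra.norm F x)) = algebraMap F ℂ (Algebra.norm F x) := rfl
  rw [h1, hN]
  symm
  refine Finset.prod_bij (fun τ _ => τ.toRingHom) ?_ ?_ ?_ ?_
  · intro τ _
    simp only [Finset.mem_filter, Finset.mem_univ, true_and]
    exact τ.comp_algebraMap
  · intro τ₁ _ τ₂ _ h
    exact AlgHom.coe_ringHom_injective h
  · intro ψ hψ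
    simp only [Finset.mem_filter, Finset.mem_univ, true_and] at hψ
    refine ⟨{ toRingHom := ψ, commutes' := fun c => ?_ }, Finset.mem_univ _, rfl⟩
    exact DFunLike.congr_fun hψ c
  · intro τ _
    rfl

/-- **`ψ|_{ℚ(s)} = σ|_{ℚ(s)} ↔ ψ(s) = σ(s)`**: two embeddings agree on the subfield generated by `s` iff they agree
at `s` (the equaliser of `ψ` and `σ` is a subfield).
research route conditional on HC_CM; not a corollary; Q11.4-sentence-2 already refuted in dim ≥ 3. [folklore] -/
theorem comp_algebraMap_adjoin_eq_iff (s : L) (ψ σ : L →+* ℂ) :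
    ψ.comp (algebraMap ℚ⟮s⟯ L) = σ.comp (algebraMap ℚ⟮s⟯ L) ↔ ψ s = σ s := by
  constructor
  · intro h
    have h1 := DFunLike.congr_fun h (AdjoinSimple.gen ℚ s)
    simp only [RingHom.coe_comp, Function.comp_apply, AdjoinSimple.algebraMap_gen] at h1
    exact h1
  · intro h
    set E : IntermediateField ℚ L := (ψ.eqLocusField σ).toIntermediateField (fun q => by
      change ψ (algebraMap ℚ L q) = σ (algebraMap ℚ L q)
      simp) with hE
    have hle : ℚ⟮s⟯ ≤ E := adjoin_simple_le_iff.mpr h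
    ext y
    exact hle y.2

end Norm

/-! ### §3 The twisted obstruction for a CM field under «relative norms of real units are totally positive» -/

section Engine

variable {K : Type} [Field K] [NumberField K] [IsCMField K] (Φ : CMType K)
  (𝔪 : (FractionalIdeal (𝓞 K)⁰ K)ˣ) {ζ₀ : K} {𝔣₀ : Ideal (𝓞 (maximalRealSubfield K))}

/-- **The `Φ`-product over the embeddings agreeing with `φ₀` at `s` is a relative norm**: for `s, x ∈ K⁺` and
`φ₀ : K → ℂ`, `∏_{φ ∈ Φ, φ(s) = φ₀(s)} (x)^φ = φ₀|_{K⁺}(N_{K⁺/ℚ(s)}(x))` (restriction to `K⁺` is a bijection from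
`Φ` onto the embeddings of `K⁺`, part 2; then §2).
research route conditional on HC_CM; not a corollary; Q11.4-sentence-2 already refuted in dim ≥ 3. [folklore] -/
theorem prod_filter_embedding_eq_norm (s x : maximalRealSubfield K) (φ₀ : K →+* ℂ) :
    ∏ φ ∈ univ.filter (fun φ : Φ.1 => φ.1 (s : K) = φ₀ (s : K)),
        φ.1 (algebraMap (maximalRealSubfield K) K x) =
      (φ₀.comp (algebraMap (maximalRealSubfield K) K))
        (algebraMap ℚ⟮s⟯ (maximalRealSubfield K) (Algebra.norm ℚ⟮s⟯ x)) := by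
  set σ : maximalRealSubfield K →+* ℂ := φ₀.comp (algebraMap (maximalRealSubfield K) K) with hσ
  rw [← prod_filter_eq_norm ℚ⟮s⟯ x σ]
  refine Finset.prod_bij (fun φ _ => φ.1.comp (algebraMap (maximalRealSubfield K) K)) ?_ ?_ ?_ ?_
  · intro φ hφ
    simp only [Finset.mem_filter, Finset.mem_univ, true_and] at hφ ⊢
    rw [comp_algebraMap_adjoin_eq_iff]
    exact hφ
  · intro φ₁ _ φ₂ _ h
    exact comp_algebraMap_injective Φ h
  · intro ψ hψ
    simp only [Finset.mem_filter, Finset.mem_univ, true_and] at hψ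
    rw [comp_algebraMap_adjoin_eq_iff] at hψ
    obtain ⟨φ, hφ⟩ := (comp_algebraMap_bijective Φ).2 ψ
    refine ⟨φ, ?_, hφ⟩
    simp only [Finset.mem_filter, Finset.mem_univ, true_and]
    have h1 : φ.1 (s : K) = ψ s := by rw [← hφ]; rfl
    rw [h1, hψ]; rfl
  · intro φ _
    rfl

/-- **Real parts**: `∏_{φ ∈ Φ, φ(s) = φ₀(s)} Re (x)^φ = Re φ₀|_{K⁺}(N_{K⁺/ℚ(s)}(x))` for `s, x ∈ K⁺` (every `x^φ` is
real).
research route conditional on HC_CM; not a corollary; Q11.4-sentence-2 already refuted in dim ≥ 3. [folklore] -/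
theorem prod_filter_re_embedding_eq_re_norm (s x : maximalRealSubfield K) (φ₀ : K →+* ℂ) :
    ∏ φ ∈ univ.filter (fun φ : Φ.1 => φ.1 (s : K) = φ₀ (s : K)),
        (φ.1 (algebraMap (maximalRealSubfield K) K x)).re =
      ((φ₀.comp (algebraMap (maximalRealSubfield K) K))
        (algebraMap ℚ⟮s⟯ (maximalRealSubfield K) (Algebra.norm ℚ⟮s⟯ x))).re := by
  rw [← prod_filter_embedding_eq_norm Φ s x φ₀]
  have hreal : ∀ φ : Φ.1, φ.1 (algebraMap (maximalRealSubfield K) K x) =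
      (((φ.1 (algebraMap (maximalRealSubfield K) K x)).re : ℝ) : ℂ) := fun φ =>
    Complex.ext (by simp) (by
      rw [Complex.ofReal_im]
      exact im_embedding_eq_zero_of_complexConj_eq ((IsCMField.complexConj_eq_self_iff K _).mpr x.2) φ.1)
  rw [Finset.prod_congr rfl (fun φ _ => hreal φ), ← Complex.ofReal_prod, Complex.ofReal_re]

/-- **THE TWISTED ENGINE.**  Let `K` be a CM field, `s ∈ K⁺`, and suppose every unit `v` of `𝓞 K⁺` has
`Re σ(N_{K⁺/ℚ(s)}(v)) > 0` for EVERY embedding `σ : K⁺ → ℂ` (the relative norm of every real unit to `ℚ(s)` is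
TOTALLY POSITIVE).  If the skew `ζ₀ ≠ 0` of type `𝔣₀` (`𝔬𝔣₀ = ζ₀𝔡𝔪𝔪^ρ`) is negative at an ODD number of the
`φ ∈ Φ` with `φ(s) = φ₀(s)` for some `φ₀`, then `ℂ^Φ/D(𝔪)` carries NO `Φ`-positive divisor `X_ζ` of type `𝔣₀` —
for `𝔣₀ = 𝔬₀`: the CM pair `(ℂ^Φ/D(𝔪), ι)` is NOT principally polarisable.  (Census b01.25 (A): the functional
`λ = Σ_{χ′(t) = +1}` annihilates `Sig(E⁺)`, so an `s_Φ` with `λ(s_Φ) = 1` is no unit's sign vector.)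
research route conditional on HC_CM; not a corollary; Q11.4-sentence-2 already refuted in dim ≥ 3. [cite: Shimura1998, §14.3 Prop. 5, p. 104] -/
theorem not_exists_pos_isOfType_of_relNorm_pos_of_odd (hζ₀ : IsCMField.complexConj K ζ₀ = -ζ₀) (h0 : ζ₀ ≠ 0)
    (hT : IsOfType 𝔪 ζ₀ 𝔣₀) (s : maximalRealSubfield K)
    (hN : ∀ v : (𝓞 (maximalRealSubfield K))ˣ, ∀ σ : maximalRealSubfield K →+* ℂ,
      0 < (σ (algebraMap ℚ⟮s⟯ (maximalRealSubfield K)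
        (Algebra.norm ℚ⟮s⟯ (((v : 𝓞 (maximalRealSubfield K)) : maximalRealSubfield K))))).re)
    (φ₀ : K →+* ℂ) (hodd : Odd ((Φ.1 ∩ {ψ | ψ (s : K) = φ₀ (s : K) ∧ (ψ ζ₀).im < 0}).ncard)) :
    ¬ ∃ ζ : K, IsCMField.complexConj K ζ = -ζ ∧ (∀ φ : Φ.1, 0 < (φ.1 ζ).im) ∧ IsOfType 𝔪 ζ 𝔣₀ := by
  refine not_exists_pos_isOfType_of_odd_on Φ 𝔪 {ψ | ψ (s : K) = φ₀ (s : K)} hζ₀ h0 hT (fun u hu => ?_) hodd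
  obtain ⟨v, hv⟩ := (IsCMField.Units.complexConj_eq_self_iff K u).mp hu
  have h1 : (algebraMap (𝓞 K) K) (u : 𝓞 K) = ((u : 𝓞 K) : K) := rfl
  have hv' : ((u : 𝓞 K) : K) = algebraMap (maximalRealSubfield K) K
      ((v : 𝓞 (maximalRealSubfield K)) : maximalRealSubfield K) := by
    rw [← h1, ← hv, IsScalarTower.algebraMap_apply (𝓞 (maximalRealSubfield K)) (maximalRealSubfield K) K]
  simp_rw [Set.mem_setOf_eq, hv']
  rw [prod_filter_re_embedding_eq_re_norm Φ s _ φ₀]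
  exact hN v _

end Engine

end Summit.HodgeConjecture.Ring2WeilCoverage.TwistedUnitSignature

end
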